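import Summits.HubbardSuperconductivity.HubbardLadder.HubbardTwoPoleClosedForm
import HarnessLib

/-!
# The two-pole (`2 × 2`) semidefinite certificate, V: a square-root-free floor (how a number attaches)

HONEST FRAMING (page 1): ladder R1–R4 with certified numbers; no claim on H/H₀; first certified
bounds; not a superconductivity verdict. A SOUNDNESS EDGE of the pub-hubbard cell (seat `pseudo` g64,
`PSEUDO.md` §110 / `records/tools-g64/LEAN-TWOPOLE-CLOSEDFORM.md` §4; staged, NOT filed — the FILER
decision is the desk's; NO case is evaluated here). The closed form of part III,
`E_L(2n) ≥ Σ_σ (Σ_k certValue (-ε̃_k + μ_σ) (λ_σ/2) (U/2 - λ_σ) ρ - μ_σ n)`, contains one square root per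
momentum (`certValue = min 0 e₊ + min 0 e₋`, `e± = (τ ± √D)/2`). This file removes it for an exact
checker: `certValue` is non-decreasing in the trace `τ` and non-increasing in `√D`, so ANY data
`τ' ≤ τ`, `r ≥ 0`, `r² ≥ D` (rational, say) gives `min 0 ((τ' + r)/2) + min 0 ((τ' - r)/2) ≤ certValue`
(`rationalFloor_le_certValue`), and hence a square-root-free lower bound on `E_L(2n)`
(`hubbardTorus_groundEnergyAt_ge_twoPole_rationalFloor`) whose hypotheses are polynomial inequalities
in the data; `pencilTrace_twoPole` / `pencilDisc_twoPole` spell `τ` and `D` out as polynomials in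
`(ε̃_k, μ, λ, U, ρ)`, and `quadratic_le_max_endpoints` bounds the momentum dependence of `D` (a monic
quadratic in `ε̃_k`) on an enclosing interval by its endpoint values, for tori whose band values are
irrational (`L = 8, 12`). [cite: LangerMattis1971, eq. (5)][folklore]. All statements are PROVED (no
placeholders, no named facts); no new axioms, no instances, no notation; no number is produced.
-/

noncomputable section

namespace Summit.HubbardSuperconductivity.HubbardLadder

open Matrix Finset Literature.MathematicalPhysics.QuantumLattice
  Literature.MathematicalPhysics.QuantumLattice.LangerMattis
  Literature.MathematicalPhysics.QuantumLattice.RayleighBound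
  Literature.Probability.LatticeModels TwoPoleCertificate
open scoped ComplexOrder ComplexConjugate

namespace TwoPoleCertificate

/-- **Monotonicity of the certificate value in its data.** For `0 ≤ x ≤ r` and `τ' ≤ τ`:
`min 0 ((τ' + r)/2) + min 0 ((τ' - r)/2) ≤ min 0 ((τ + x)/2) + min 0 ((τ - x)/2)`
(the value `min 0 e₊ + min 0 e₋ = min (0, e₋, τ)` is non-decreasing in `τ` and non-increasing in the
root gap). [folklore] -/
theorem minZero_add_minZero_mono {τ τ' x r : ℝ} (hτ : τ' ≤ τ) (hx : 0 ≤ x) (hxr : x ≤ r) :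
    min 0 ((τ' + r) / 2) + min 0 ((τ' - r) / 2) ≤ min 0 ((τ + x) / 2) + min 0 ((τ - x) / 2) := by
  have ha := min_le_left (0 : ℝ) ((τ' + r) / 2)
  have hb := min_le_right (0 : ℝ) ((τ' + r) / 2)
  have hc := min_le_left (0 : ℝ) ((τ' - r) / 2)
  have hd := min_le_right (0 : ℝ) ((τ' - r) / 2)
  rcases le_or_gt 0 ((τ + x) / 2) with hp | hp <;> rcases le_or_gt 0 ((τ - x) / 2) with hq | hq
  · rw [min_eq_left hp, min_eq_left hq]
    linarith
  · rw [min_eq_left hp, min_eq_right hq.le]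
    linarith
  · exfalso
    linarith
  · rw [min_eq_right hp.le, min_eq_right hq.le]
    linarith

/-- **The square-root-free floor of the certificate value.** For any `ρ` and any data
`τ' ≤ τ(a,b,d,ρ)`, `r ≥ 0` with `D(a,b,d,ρ) ≤ r²`:
`min 0 ((τ' + r)/2) + min 0 ((τ' - r)/2) ≤ certValue a b d ρ`. [folklore] -/
theorem rationalFloor_le_certValue (a b d ρ : ℝ) {τ' r : ℝ}
    (hτ : τ' ≤ pencilTrace a b d ρ) (hr0 : 0 ≤ r) (hr : pencilDisc a b d ρ ≤ r ^ 2) :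
    min 0 ((τ' + r) / 2) + min 0 ((τ' - r) / 2) ≤ certValue a b d ρ := by
  have hx : 0 ≤ Real.sqrt (pencilDisc a b d ρ) := Real.sqrt_nonneg _
  have hxr : Real.sqrt (pencilDisc a b d ρ) ≤ r := by
    calc Real.sqrt (pencilDisc a b d ρ) ≤ Real.sqrt (r ^ 2) := Real.sqrt_le_sqrt hr
      _ = r := Real.sqrt_sq hr0
  have h := minZero_add_minZero_mono hτ hx hxr
  simpa [certValue, rootHi, rootLo] using h

/-- The two-pole trace is affine in the band value: for `a = -s + μ`, `b = λ/2`, `d = U/2 - λ`,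
`τ = -s + μ + ρU/2`. [folklore] -/
theorem pencilTrace_twoPole (s μ lam U ρ : ℝ) :
    pencilTrace (-s + μ) (lam / 2) (U / 2 - lam) ρ = -s + μ + ρ * U / 2 := by
  simp only [pencilTrace]
  ring

/-- The two-pole discriminant as a polynomial (monic quadratic in the band value `s`):
`D = (-s + μ + ρU/2)² - 4((-s + μ)(U/2 - λ) - λ²/4) ρ(1-ρ)`. [folklore] -/
theorem pencilDisc_twoPole (s μ lam U ρ : ℝ) :
    pencilDisc (-s + μ) (lam / 2) (U / 2 - lam) ρ =
      (-s + μ + ρ * U / 2) ^ 2 - 4 * ((-s + μ) * (U / 2 - lam) - (lam / 2) ^ 2) * (ρ * (1 - ρ)) := by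
  simp only [pencilDisc, pencilTrace, pencilDet]
  ring

/-- A monic quadratic on an interval is bounded by its endpoint values:
`lo ≤ s ≤ hi ⇒ s² + βs + γ ≤ max (lo² + βlo + γ) (hi² + βhi + γ)`. [folklore] -/
theorem quadratic_le_max_endpoints (β γ : ℝ) {lo hi s : ℝ} (hlo : lo ≤ s) (hhi : s ≤ hi) :
    s ^ 2 + β * s + γ ≤ max (lo ^ 2 + β * lo + γ) (hi ^ 2 + β * hi + γ) := by
  rcases le_or_gt (s + lo + β) 0 with h | h
  · have : s ^ 2 + β * s + γ ≤ lo ^ 2 + β * lo + γ := by nlinarith [mul_nonneg (sub_nonneg.mpr hlo) (neg_nonneg.mpr h)]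
    exact this.trans (le_max_left _ _)
  · have : s ^ 2 + β * s + γ ≤ hi ^ 2 + β * hi + γ := by
      nlinarith [mul_nonneg (sub_nonneg.mpr hhi) (by linarith : (0 : ℝ) ≤ s + hi + β)]
    exact this.trans (le_max_right _ _)

end TwoPoleCertificate

variable {d L : ℕ} [NeZero L]

/-- **The square-root-free two-pole floor on the Hubbard torus** `(ℤ/Lℤ)^d`, `L ≥ 3`, any real `t, U`,
`0 < n < L^d`, `ρ = n/L^d`, any multipliers `μ_σ, λ_σ`: if per spin and momentum the data
`τ'_{σk} ≤ τ_{σk}`, `r_{σk} ≥ 0`, `D_{σk} ≤ r_{σk}²` are supplied (polynomial inequalities, see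
`pencilTrace_twoPole` / `pencilDisc_twoPole`), then
`Σ_σ (Σ_k (min 0 ((τ' + r)/2) + min 0 ((τ' - r)/2)) - μ_σ n) ≤ E_L(2n)`.
This is the form in which a certified NUMBER from the two-pole class attaches to the kernel: no square
root, no semidefinite programme, no certificate search. [cite: LangerMattis1971, eq. (5)][folklore] -/
theorem hubbardTorus_groundEnergyAt_ge_twoPole_rationalFloor (hL : 3 ≤ L) (t U : ℝ) (μ lam : Fin 2 → ℝ)
    {n : ℕ} (hn0 : 0 < n) (hn : n < L ^ d) (τ' r : Fin 2 → FermionTorus d L → ℝ)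
    (hτ : ∀ σ k, τ' σ k ≤
      pencilTrace (-(siteBand t k) + μ σ) (lam σ / 2) (U / 2 - lam σ) ((n : ℝ) / (L : ℝ) ^ d))
    (hr0 : ∀ σ k, 0 ≤ r σ k)
    (hr : ∀ σ k,
      pencilDisc (-(siteBand t k) + μ σ) (lam σ / 2) (U / 2 - lam σ) ((n : ℝ) / (L : ℝ) ^ d) ≤ r σ k ^ 2) :
    ∑ σ : Fin 2, ((∑ k : FermionTorus d L, (min 0 ((τ' σ k + r σ k) / 2) + min 0 ((τ' σ k - r σ k) / 2))) -
        μ σ * n) ≤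
      groundEnergyAt (fermionTorusGraph d L) t U (2 * n) := by
  refine le_trans ?_ (hubbardTorus_groundEnergyAt_ge_twoPole_closedForm hL t U μ lam hn0 hn)
  refine Finset.sum_le_sum fun σ _ => sub_le_sub_right ?_ _
  exact Finset.sum_le_sum fun k _ => rationalFloor_le_certValue _ _ _ _ (hτ σ k) (hr0 σ k) (hr σ k)

end Summit.HubbardSuperconductivity.HubbardLadder
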